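import Summits.RiemannHypothesis.RiemannHypothesis.Theorems.WeilParityOffLineParityDetectionLocLaplace
import Literature.NumberTheory.LFunctions.WeilGroundEnergyParitySplit
import HarnessLib

/-!
# The profile of an even window test and its smooth cutoff (helper file for stub LOC)

Route `WeilParity`, crux `OffLineParityDetection` (item stmt-RiemannHypothesis-15431), line
`registered`, stub `stub_finiteDefectLocalisation` (LOC).  Pure real analysis, no zeta facts and
no definitions.

* `loc_evenProfile`: for a real-valued even Weil test `e` supported in `[-a, a]` (`a ≥ 0`) with
  `∫ |e|² = 1`, the PROFILE `p(u) = Re e(a - u)` is a smooth compactly supported real function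
  with `tsupport p ⊆ [0, ∞)` (it vanishes on `(-∞, 0]` because `e` vanishes off the open window
  `(-a, a)`), `e(t) = p(a - t)`, `∫₀^∞ p² = 1`, and HALF MASS ON THE NEAR HALF,
  `∫_{(0, a]} p² ≤ 1/2` (by evenness `∫_{t > 0} |e|² = 1/2`).
* `loc_cutoff`: with the smooth step `ψ(u) = smoothTransition (a - u)` (`= 1` for `u ≤ a - 1`,
  `= 0` for `u ≥ a`, values in `[0, 1]`), a profile `p` vanishing on `(-∞, 0]` splits as
  `p = g + h`, `g = ψ p` (smooth, compactly supported, `tsupport g ⊆ [0, ∞)`,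
  `∫₀^∞ g² ≤ ∫_{(0,a]} p²`) and `h = (1 - ψ) p` (continuous, compactly supported, `h = 0` on
  `(-∞, a - 1]`, `∫₀^∞ h² ≤ ∫₀^∞ p²`).
-/

set_option linter.dupNamespace false

noncomputable section

namespace Summit.RiemannHypothesis.RiemannHypothesis.Theorems.WeilParityOffLineParityDetection

open MeasureTheory Set Filter
open scoped ComplexConjugate
open Literature.NumberTheory.LFunctions

/-- For an even function `e`, `∫ ‖e‖² = 2 ∫_{t > 0} ‖e‖²` (`integral_comp_abs`). [folklore] -/
theorem loc_integral_norm_sq_even {e : ℝ → ℂ} (heven : ∀ t, e (-t) = e t) :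
    ∫ t, ‖e t‖ ^ 2 = 2 * ∫ t in Ioi (0 : ℝ), ‖e t‖ ^ 2 := by
  rw [← integral_comp_abs (f := fun t ↦ ‖e t‖ ^ 2)]
  congr 1 with t
  rcases le_or_gt 0 t with ht | ht
  · rw [abs_of_nonneg ht]
  · rw [abs_of_neg ht, heven]

/-- The square of a continuous compactly supported real function is integrable. [folklore] -/
theorem loc_integrable_sq {φ : ℝ → ℝ} (hφ : Continuous φ) (hφs : HasCompactSupport φ) :
    Integrable fun u ↦ φ u ^ 2 := by
  have hc2 : HasCompactSupport (fun u ↦ φ u ^ 2) :=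
    hφs.comp_left (g := fun x : ℝ ↦ x ^ 2) (zero_pow two_ne_zero)
  exact (hφ.pow 2).integrable_of_hasCompactSupport hc2

/-- **The profile of an even window test** (registered sub-goal of the item, closed form).  For a
real-valued even Weil test `e` supported in `[-a, a]` (`a ≥ 0`) with `∫ |e|² = 1`, the profile
`p(u) = Re e(a - u)` is smooth, compactly supported, `tsupport p ⊆ [0, ∞)`, vanishes on `(-∞, 0]`,
recovers `e(t) = p(a - t)`, and has `∫₀^∞ p² = 1`, `∫_{(0,a]} p² ≤ 1/2`. [folklore] -/
theorem loc_evenProfile :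
    ∀ (a : ℝ) (e : ℝ → ℂ), 0 ≤ a → IsWeilTest e → tsupport e ⊆ Set.Icc (-a) a →
      (∀ t, e (-t) = e t) → (∀ t, (e t).im = 0) → ∫ t, ‖e t‖ ^ 2 = (1 : ℝ) →
      ∀ p : ℝ → ℝ, (∀ u, p u = (e (a - u)).re) →
      ContDiff ℝ (⊤ : ℕ∞) p ∧ HasCompactSupport p ∧ tsupport p ⊆ Set.Ici 0 ∧
        (∀ u ≤ 0, p u = 0) ∧ (∀ t, e t = ((p (a - t) : ℝ) : ℂ)) ∧
        ∫ u in Set.Ioi (0 : ℝ), p u ^ 2 = 1 ∧ ∫ u in Set.Ioc 0 a, p u ^ 2 ≤ 1 / 2 := by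
  intro a e ha he hsupp heven hreal hnorm p hp
  have hpf : p = fun u ↦ (e (a - u)).re := funext hp
  have he0 : ∀ t, t ∉ Ioo (-a) a → e t = 0 := fun t ht ↦
    loc_eq_zero_of_notMem_interior he.1.continuous hsupp (by rwa [interior_Icc])
  have hp0 : ∀ u ≤ 0, p u = 0 := fun u hu ↦ by
    rw [hp, he0 (a - u) (fun h ↦ by linarith [h.2]), Complex.zero_re]
  have hp2a : ∀ u, 2 * a ≤ u → p u = 0 := fun u hu ↦ by
    rw [hp, he0 (a - u) (fun h ↦ by linarith [h.1]), Complex.zero_re]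
  have hpK : ∀ u, u ∉ Icc 0 (2 * a) → p u = 0 := fun u hu ↦ by
    simp only [mem_Icc, not_and_or, not_le] at hu
    rcases hu with h | h
    · exact hp0 u h.le
    · exact hp2a u h.le
  have hps : ContDiff ℝ (⊤ : ℕ∞) p := by
    rw [hpf]
    exact Complex.reCLM.contDiff.comp (he.1.comp (contDiff_const.sub contDiff_id))
  have hpc : HasCompactSupport p := HasCompactSupport.intro isCompact_Icc hpK
  have hnormsq : ∀ x, ‖e x‖ ^ 2 = (e x).re ^ 2 := fun x ↦ by
    rw [Complex.sq_norm, Complex.normSq_apply, hreal x]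
    ring
  have hpsq : ∀ u, p u ^ 2 = ‖e (a - u)‖ ^ 2 := fun u ↦ by rw [hnormsq, hp]
  have hIe : Integrable fun t ↦ ‖e t‖ ^ 2 := he.integrable_norm_sq
  refine ⟨hps, hpc, loc_tsupport_subset isClosed_Ici fun u hu ↦ hp0 u (le_of_lt (not_le.1 hu)),
    hp0, fun t ↦ ?_, ?_, ?_⟩
  · -- `e(t) = p(a - t)`
    rw [hp, sub_sub_cancel]
    exact Complex.ext (by simp) (by simp [hreal t])
  · -- `∫₀^∞ p² = ∫ p² = ∫ |e|² = 1`
    rw [setIntegral_eq_integral_of_forall_compl_eq_zero (fun u hu ↦ by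
      rw [hp0 u (not_lt.1 hu), zero_pow two_ne_zero])]
    simp_rw [hpsq]
    rw [integral_sub_left_eq_self (fun u ↦ ‖e u‖ ^ 2) volume a, hnorm]
  · -- half of the mass lies on `(0, a]`
    have hhalf : ∫ t in Ioi (0 : ℝ), ‖e t‖ ^ 2 = 1 / 2 := by
      have h := loc_integral_norm_sq_even heven
      rw [hnorm] at h
      linarith
    calc ∫ u in Ioc 0 a, p u ^ 2 = ∫ u in 0..a, ‖e (a - u)‖ ^ 2 := by
          rw [intervalIntegral.integral_of_le ha]
          exact setIntegral_congr_fun measurableSet_Ioc fun u _ ↦ hpsq u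
      _ = ∫ u in 0..a, ‖e u‖ ^ 2 := by
          rw [intervalIntegral.integral_comp_sub_left (fun u ↦ ‖e u‖ ^ 2) a, sub_self, sub_zero]
      _ = ∫ u in Ioc 0 a, ‖e u‖ ^ 2 := intervalIntegral.integral_of_le ha
      _ ≤ ∫ u in Ioi (0 : ℝ), ‖e u‖ ^ 2 :=
          setIntegral_mono_set hIe.integrableOn (Eventually.of_forall fun u ↦ sq_nonneg ‖e u‖)
            Ioc_subset_Ioi_self.eventuallyLE
      _ = 1 / 2 := hhalf

/-- **The smooth cutoff of a profile.**  For a smooth compactly supported profile `p` vanishing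
on `(-∞, 0]` and the smooth step `ψ(u) = smoothTransition (a - u)`: `g = ψ p` is smooth,
compactly supported with `tsupport g ⊆ [0, ∞)` and `∫₀^∞ g² ≤ ∫_{(0,a]} p²` (`g = 0` for
`u ≥ a`, `0 ≤ ψ ≤ 1`); `h = (1 - ψ) p` is continuous, compactly supported, vanishes on
`(-∞, a - 1]` (`ψ = 1` there) with `∫₀^∞ h² ≤ ∫₀^∞ p²`; and `p = g + h`. [folklore] -/
theorem loc_cutoff {p : ℝ → ℝ} (hps : ContDiff ℝ (⊤ : ℕ∞) p) (hpc : HasCompactSupport p)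
    (hp0 : ∀ u ≤ 0, p u = 0) (a : ℝ) {g h : ℝ → ℝ}
    (hg : ∀ u, g u = Real.smoothTransition (a - u) * p u)
    (hh : ∀ u, h u = (1 - Real.smoothTransition (a - u)) * p u) :
    ContDiff ℝ (⊤ : ℕ∞) g ∧ HasCompactSupport g ∧ tsupport g ⊆ Ici 0 ∧
      Continuous h ∧ HasCompactSupport h ∧ (∀ u ≤ a - 1, h u = 0) ∧ (∀ u, p u = g u + h u) ∧
      ∫ u in Ioi (0 : ℝ), g u ^ 2 ≤ ∫ u in Ioc 0 a, p u ^ 2 ∧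
      ∫ u in Ioi (0 : ℝ), h u ^ 2 ≤ ∫ u in Ioi (0 : ℝ), p u ^ 2 := by
  have hgf : g = fun u ↦ Real.smoothTransition (a - u) * p u := funext hg
  have hhf : h = fun u ↦ (1 - Real.smoothTransition (a - u)) * p u := funext hh
  have hψs : ContDiff ℝ (⊤ : ℕ∞) fun u ↦ Real.smoothTransition (a - u) :=
    Real.smoothTransition.contDiff.comp (contDiff_const.sub contDiff_id)
  have hψ0 : ∀ u, 0 ≤ Real.smoothTransition (a - u) := fun u ↦ Real.smoothTransition.nonneg _
  have hψ1 : ∀ u, Real.smoothTransition (a - u) ≤ 1 := fun u ↦ Real.smoothTransition.le_one _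
  have hgs : ContDiff ℝ (⊤ : ℕ∞) g := by
    rw [hgf]
    exact hψs.mul hps
  have hgc : HasCompactSupport g := by
    rw [hgf]
    exact hpc.mul_left (f := fun u ↦ Real.smoothTransition (a - u))
  have hhc' : Continuous h := by
    rw [hhf]
    exact (contDiff_const.sub hψs).continuous.mul hps.continuous
  have hhc : HasCompactSupport h := by
    rw [hhf]
    exact hpc.mul_left (f := fun u ↦ 1 - Real.smoothTransition (a - u))
  have hpI : Integrable fun u ↦ p u ^ 2 := loc_integrable_sq hps.continuous hpc
  have hgI : Integrable fun u ↦ g u ^ 2 := loc_integrable_sq hgs.continuous hgc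
  have hhI : Integrable fun u ↦ h u ^ 2 := loc_integrable_sq hhc' hhc
  -- pointwise comparisons `g² ≤ p²`, `h² ≤ p²`
  have hg2 : ∀ u, g u ^ 2 ≤ p u ^ 2 := fun u ↦ by
    rw [hg, mul_pow]
    exact mul_le_of_le_one_left (sq_nonneg _) (pow_le_one₀ (hψ0 u) (hψ1 u))
  have hh2 : ∀ u, h u ^ 2 ≤ p u ^ 2 := fun u ↦ by
    rw [hh, mul_pow]
    refine mul_le_of_le_one_left (sq_nonneg _) (pow_le_one₀ ?_ ?_)
    · linarith [hψ1 u]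
    · linarith [hψ0 u]
  have hga : ∀ u, a ≤ u → g u = 0 := fun u hu ↦ by
    rw [hg, Real.smoothTransition.zero_of_nonpos (by linarith), zero_mul]
  refine ⟨hgs, hgc, loc_tsupport_subset isClosed_Ici fun u hu ↦ ?_, hhc', hhc, fun u hu ↦ ?_,
    fun u ↦ ?_, ?_, ?_⟩
  · rw [hg, hp0 u (le_of_lt (not_le.1 hu)), mul_zero]
  · rw [hh, Real.smoothTransition.one_of_one_le (by linarith), sub_self, zero_mul]
  · rw [hg, hh]
    ring
  · -- `∫₀^∞ g² = ∫_{(0,a]} g² ≤ ∫_{(0,a]} p²`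
    rw [setIntegral_eq_of_subset_of_forall_sdiff_eq_zero measurableSet_Ioi Ioc_subset_Ioi_self
      (fun u hu ↦ by
        have hu' : a ≤ u := by
          by_contra hlt
          exact hu.2 ⟨hu.1, le_of_lt (not_le.1 hlt)⟩
        rw [hga u hu', zero_pow two_ne_zero])]
    exact setIntegral_mono_on hgI.integrableOn hpI.integrableOn measurableSet_Ioc fun u _ ↦ hg2 u
  · exact setIntegral_mono_on hhI.integrableOn hpI.integrableOn measurableSet_Ioi fun u _ ↦ hh2 u

end Summit.RiemannHypothesis.RiemannHypothesis.Theorems.WeilParityOffLineParityDetection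

end
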